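import Mathlib
import Summits.Ventures.HodgeRepro.Tier4.Target
import Summits.Ventures.HodgeRepro.Tier4.Line3.Defs
import Summits.Ventures.HodgeRepro.Tier4.Line3.DefsLemmas
import Summits.Ventures.HodgeRepro.Tier4.Line3.MainClassReps
import Summits.Ventures.HodgeRepro.Tier4.Line3.GoodSplitBracket
import Summits.Ventures.HodgeRepro.Tier4.Line3.BadPlaceBracket
import Summits.Ventures.HodgeRepro.Tier4.Line3.PosOfFactorisation

/-!
# Tier4/Line3/PosOfFactorisationAt — termwise positivity from the displayed local factorisation, GENERIC in the localiser
(level/loc functions) and in the base tuple — the ray form (R6) for the O-L3-8 repair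

Blind re-derivation cell `pub-hodge-repro`, Tier 4 «PROVE THE STEP» (README §9–§10), LINE L3, seat t4-L3-p1 (g2).  After the
interface finding O-L3-8 (t4-L3-p2 g2 S13369, adjudicated by t4-plan-3 g2 S13393: `LocS.supp` + `main_one` are unsatisfiable on
scalar-symmetric data, so every `LocS`-based hypothesis of L3 v0.25–v0.38 is vacuous there), the repair v0.39 replaces the
localiser by `LocSU` (support up to ALL scalar copies) and the main orbit by the GRAM RAY (the orbits of the scalar copies of
`xm`), and its positivity input (R6) is «`LocalFactorisation` + `FaceIdentity` at EVERY ray representative».  This module is the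
landed `Tier4/Line3/PosOfFactorisation.lean` (p674392 + p674516) made GENERIC: the localiser is replaced by its two functions
`level : ℕ → X.Level`, `loc : ∀ N, X.Tr (level N)` (nothing else of it is used), and the base tuple `y` is free — so the successor
planner's `LocSU` / `GramRay` consume it by name whatever they are called, and the module survives the `LocS → LocSU`
regeneration untouched (nothing of `LocS` is used; `PosOfFactorisation` is imported only for the shared brackets and lemmas).

* `LocalFactorisationAt D level loc y` — the displayed factorisation of `coefQ D.cf (loc N) (mainRep (level N) y c)` at the
  main classes of the base tuple `y`: the same fields as the landed structure (`bad`, `u`, `vol`, `μ`, `n`, `good_integral`,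
  `good_unit`, `N₀`, `factor`); `LocalFactorisationAt.BadConditions`, `LocalFactorisationAt.FaceIdentity` as before.
* `pos_of_faceIdentityAt`: the clause `LocPS.pos` at `y` (one `N₀`, every class).
* `pos_on_set_of_faceIdentity`: THE RAY FORM — for a set `S` of base tuples with a factorisation + face identity at each `y ∈ S`
  and a UNIFORM depth `N₀` (`∀ y ∈ S, (F y).N₀ ≤ N₀`): `∀ N ≥ N₀, ∀ y ∈ S, ∀ c, (coefQ D.cf (loc N) (mainRep (level N) y c)).im = 0
  ∧ 0 ≤ (…).re` — `LocPSU.posRay` of the v0.39 design (S13393 (R5)) is this with `S := {y | orbitOf (lines y) ∈ GramRay xm}`.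
* The landed `LocalFactorisation D p L₀ xm ℓ` (PosOfFactorisation.lean) is the special case `level := ℓ.level`, `loc := ℓ.loc`,
  `y := xm` of `LocalFactorisationAt` field by field (no bridge lemma is stated: the `LocS` side is vacuous on natural data by O-L3-8
  and is not consumed).

What is NOT here: the factorisation itself (unprinted), the face identity (false on the twisted members — SCOPE unchanged), and
the uniformity of `N₀` over the ray (a property of the natural localiser: the `𝔭`-factor at a scalar copy `s · xm` equals that at
`xm` by the local scalar symmetry, S13393 (R6)) — all DISPLAYED.  Nothing here asserts anything about the truth of (P); HC_CM is NOT
proved by anyone in this repository.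
-/

set_option autoImplicit false

noncomputable section

namespace Summit.Ventures.HodgeRepro.Tier4.Line3

open Summit.Ventures.HodgeRepro.Tier4
open Matrix
open scoped ComplexConjugate WithZero

open scoped Classical

namespace T4Data

variable (X : T4Data)

/-- **THE LOCAL FACTORISATION of the localised coefficient system on the main orbit — the unprinted step of the wall,
DISPLAYED as data.**  From depth `N₀` on, at every main class `c` of the level `level N`, the coefficient
`coefQ D.cf (loc N) (mainRep c)` is a non-negative real times a finite product of local brackets at the representative:
the good-split bracket (`GoodSplitBracket`) at the places outside `bad`, the bad-place bracket (`BadPlaceBracket`, split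
model, depth `n w`) at the places of `bad`.  The good places carry the unit conditions of the natural localiser (`H` integral,
`H(xm 0, xm 0)`, `H(xm 1, xm 1)` units at `w`, `H(xm 0, xm 1)` a unit at `w` and at `w̄`). -/
structure LocalFactorisationAt (D : X.ThetaData) (level : ℕ → X.Level) (loc : ∀ N : ℕ, X.Tr (level N))
    (xm : X.Tuple) where
  /-- the bad places -/
  bad : Finset (IsDedekindDomain.HeightOneSpectrum (NumberField.RingOfIntegers X.E))
  /-- the slot-character values `μ_{j,w}(ϖ_w)` at the good split places -/
  u : IsDedekindDomain.HeightOneSpectrum (NumberField.RingOfIntegers X.E) → Fin 4 → ℂ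
  /-- the local volumes -/
  vol : IsDedekindDomain.HeightOneSpectrum (NumberField.RingOfIntegers X.E) → ℝ
  /-- the slot characters on the global proxies at the bad places -/
  μ : IsDedekindDomain.HeightOneSpectrum (NumberField.RingOfIntegers X.E) → Fin 4 → (X.E)ˣ →* ℂ
  /-- the depth of the slot balls at the bad places -/
  n : IsDedekindDomain.HeightOneSpectrum (NumberField.RingOfIntegers X.E) → ℕ
  /-- `H` is integral at every good place -/
  good_integral : ∀ w ∉ bad, ∀ i j, w.valuation X.E (X.H i j) ≤ 1
  /-- the Gram entries of the symmetric centre are units at every good place (at `w` and at `w̄`) -/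
  good_unit : ∀ w ∉ bad,
    w.valuation X.E (hform X.c X.H (xm 0) (xm 0)) = 1 ∧ w.valuation X.E (hform X.c X.H (xm 1) (xm 1)) = 1 ∧
    w.valuation X.E (hform X.c X.H (xm 0) (xm 1)) = 1 ∧ w.valuation X.E (hform X.c X.H (xm 1) (xm 0)) = 1
  /-- the depth from which the identity holds -/
  N₀ : ℕ
  /-- THE IDENTITY: coefficient = non-negative real × finite product of local brackets at the representative -/
  factor : ∀ N, N₀ ≤ N → ∀ c : X.MainClass (level N) xm,
    ∃ (A : ℝ) (T : Finset (IsDedekindDomain.HeightOneSpectrum (NumberField.RingOfIntegers X.E))), 0 ≤ A ∧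
      X.coefQ D.cf (loc N) (X.mainRep (level N) xm c) = (A : ℂ) * ∏ w ∈ T,
        (if w ∈ bad then X.badBracket w (μ w) (n w) xm (X.mainRep (level N) xm c) (vol w)
         else X.goodBracket w (u w) (vol w) (X.mainRep (level N) xm c))

namespace LocalFactorisationAt

variable {X} {D : X.ThetaData} {level : ℕ → X.Level} {loc : ∀ N : ℕ, X.Tr (level N)} {xm : X.Tuple}

/-- **THE CONDITIONS AT A BAD PLACE** (crit-2 S12745 (E): the depth `n w` is chosen after `xm` and the characters):
`H` and the centre integral at `w`, contents `m_a`, `m_b` of `xm 0`, `xm 1` and the valuation `e` of `H(xm 0, xm 1)` with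
`n w > m_a, m_b`, the slot characters trivial on `v(t − 1) ≤ ofAdd(m − n)`, `μ₁ μ̄₃` trivial on `v(t − 1) ≤ ofAdd(e − n)`, and the
face identity `ε ≡ 1` on the torus. -/
def BadConditions (F : X.LocalFactorisationAt D level loc xm)
    (w : IsDedekindDomain.HeightOneSpectrum (NumberField.RingOfIntegers X.E)) : Prop :=
  (∀ i j, w.valuation X.E (X.H i j) ≤ 1) ∧ (∀ i, w.valuation X.E (X.c (xm 0 i)) ≤ 1) ∧
  (∀ j, w.valuation X.E (xm 1 j) ≤ 1) ∧
  ∃ (i₀ j₀ : Fin 3) (ma mb e : ℤ),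
    w.valuation X.E (xm 0 i₀) = ↑(Multiplicative.ofAdd (-ma)) ∧ w.valuation X.E (xm 1 j₀) = ↑(Multiplicative.ofAdd (-mb)) ∧
    ma < F.n w ∧ mb < F.n w ∧ w.valuation X.E (hform X.c X.H (xm 0) (xm 1)) = ↑(Multiplicative.ofAdd (-e)) ∧
    (∀ j : Fin 4, ∀ t : (X.E)ˣ, w.valuation X.E ((t : X.E) - 1) ≤ ↑(Multiplicative.ofAdd (ma - F.n w)) → F.μ w j t = 1) ∧
    (∀ j : Fin 4, ∀ t : (X.E)ˣ, w.valuation X.E ((t : X.E) - 1) ≤ ↑(Multiplicative.ofAdd (mb - F.n w)) → F.μ w j t = 1) ∧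
    (∀ t : (X.E)ˣ, w.valuation X.E ((t : X.E) - 1) ≤ ↑(Multiplicative.ofAdd (e - F.n w)) →
      F.μ w 1 t * conj (F.μ w 3 t) = 1) ∧
    (∀ t : (X.E)ˣ, F.μ w 0 t * F.μ w 1 t * conj (F.μ w 2 t) * conj (F.μ w 3 t) = 1)

end LocalFactorisationAt

/-- The bad-place bracket at a main-class representative is a non-negative real under `BadConditions`. -/
theorem badBracket_mainRep_nonneg_at {D : X.ThetaData} {level : ℕ → X.Level} {loc : ∀ N : ℕ, X.Tr (level N)}
    {xm : X.Tuple} (F : X.LocalFactorisationAt D level loc xm) (w : IsDedekindDomain.HeightOneSpectrum (NumberField.RingOfIntegers X.E))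
    (hw : F.BadConditions w) (K : X.Level) (c : X.MainClass K xm) :
    (X.badBracket w (F.μ w) (F.n w) xm (X.mainRep K xm c) (F.vol w)).im = 0 ∧
      0 ≤ (X.badBracket w (F.μ w) (F.n w) xm (X.mainRep K xm c) (F.vol w)).re := by
  obtain ⟨hH, ha, hb, i₀, j₀, ma, mb, e, hia, hjb, hman, hmbn, hab, hcond_a, hcond_b, hcond_13, hε⟩ := hw
  unfold badBracket
  refine BadPlace.bracket_nonneg_of_valuation (w.valuation X.E) X.c X.H hH (F.μ w) (F.vol w) ha hb hia hjb hman hmbn hab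
    hcond_a hcond_b hcond_13 hε ?_
  rw [BadPlace.pairSplit_ι, X.hform_mainRep K xm c 0 1]

/-- **TERMWISE POSITIVITY FROM THE DISPLAYED FACTORISATION, at an explicit depth**: for `N ≥ F.N₀` and every main class `c`
of the base tuple, the localised coefficient is a non-negative real.  Inputs: the factorisation `F`, the face identity at the
good split places (`hε_good`), the conditions `BadConditions` at the bad places. -/
theorem pos_at_of_localFactorisationAt (D : X.ThetaData) (level : ℕ → X.Level) (loc : ∀ N : ℕ, X.Tr (level N))
    {xm : X.Tuple} (F : X.LocalFactorisationAt D level loc xm)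
    (hε_good : ∀ w ∉ F.bad, F.u w 0 * F.u w 1 * conj (F.u w 2) * conj (F.u w 3) = 1)
    (hbad : ∀ w ∈ F.bad, F.BadConditions w) (N : ℕ) (hN : F.N₀ ≤ N) (c : X.MainClass (level N) xm) :
    (X.coefQ D.cf (loc N) (X.mainRep (level N) xm c)).im = 0 ∧
      0 ≤ (X.coefQ D.cf (loc N) (X.mainRep (level N) xm c)).re := by
  obtain ⟨A, T, hA, hfac⟩ := F.factor N hN c
  rw [hfac]
  have hprod := prod_im_eq_zero_re_nonneg T
    (fun w => if w ∈ F.bad then X.badBracket w (F.μ w) (F.n w) xm (X.mainRep (level N) xm c) (F.vol w)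
      else X.goodBracket w (F.u w) (F.vol w) (X.mainRep (level N) xm c)) (fun w _ => by
        by_cases hw : w ∈ F.bad
        · simp only [hw, if_true]
          exact X.badBracket_mainRep_nonneg_at F w (hbad w hw) (level N) c
        · simp only [hw, if_false]
          exact X.goodBracket_mainRep_nonneg w (F.good_integral w hw) (F.u w) (hε_good w hw) (F.vol w) (level N) xm
            (F.good_unit w hw) c)
  constructor
  · rw [Complex.mul_im, Complex.ofReal_re, Complex.ofReal_im, hprod.1]
    ring
  · rw [Complex.mul_re, Complex.ofReal_re, Complex.ofReal_im]
    simp only [zero_mul, sub_zero]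
    exact mul_nonneg hA hprod.2

/-- **TERMWISE POSITIVITY FROM THE DISPLAYED FACTORISATION** — the clause `LocPS.pos` at the base tuple: from some depth on,
the localised coefficient is a non-negative real at every main class. -/
theorem pos_of_localFactorisationAt (D : X.ThetaData) (level : ℕ → X.Level) (loc : ∀ N : ℕ, X.Tr (level N))
    {xm : X.Tuple} (F : X.LocalFactorisationAt D level loc xm)
    (hε_good : ∀ w ∉ F.bad, F.u w 0 * F.u w 1 * conj (F.u w 2) * conj (F.u w 3) = 1)
    (hbad : ∀ w ∈ F.bad, F.BadConditions w) :
    ∃ N₀ : ℕ, ∀ N, N₀ ≤ N → ∀ c : X.MainClass (level N) xm,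
      (X.coefQ D.cf (loc N) (X.mainRep (level N) xm c)).im = 0 ∧
        0 ≤ (X.coefQ D.cf (loc N) (X.mainRep (level N) xm c)).re :=
  ⟨F.N₀, fun N hN c => X.pos_at_of_localFactorisationAt D level loc F hε_good hbad N hN c⟩

/-! ### The conditions packaged as ONE Prop on the structure (t4-plan-3 g2, S13086 (1)), so that the skeleton states one
hypothesis per base tuple and builds `LocPS` / `LocPSU` from `pos_of_faceIdentityAt` / `pos_on_set_of_faceIdentity` by name. -/

namespace LocalFactorisationAt

variable {X} {D : X.ThetaData} {level : ℕ → X.Level} {loc : ∀ N : ℕ, X.Tr (level N)} {xm : X.Tuple}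

/-- **THE FACE IDENTITY, with the bad-place conditions** — the one Prop beyond the factorisation data: `ε_w(ϖ_w) = 1` at every
good split place, and `BadConditions` (conductor clauses + `ε ≡ 1` on the torus) at every bad place.  This is exactly where
O-L3-7 lives: it is FALSE on the twisted members. -/
def FaceIdentity (F : X.LocalFactorisationAt D level loc xm) : Prop :=
  (∀ w ∉ F.bad, F.u w 0 * F.u w 1 * conj (F.u w 2) * conj (F.u w 3) = 1) ∧ ∀ w ∈ F.bad, F.BadConditions w

end LocalFactorisationAt

/-- **TERMWISE POSITIVITY FROM A FACTORISATION WITH THE FACE IDENTITY** — `LocPS.pos` verbatim, one hypothesis. -/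
theorem pos_of_faceIdentityAt (D : X.ThetaData) (level : ℕ → X.Level) (loc : ∀ N : ℕ, X.Tr (level N))
    {xm : X.Tuple} (F : X.LocalFactorisationAt D level loc xm) (hF : F.FaceIdentity) :
    ∃ N₀ : ℕ, ∀ N, N₀ ≤ N → ∀ c : X.MainClass (level N) xm,
      (X.coefQ D.cf (loc N) (X.mainRep (level N) xm c)).im = 0 ∧
        0 ≤ (X.coefQ D.cf (loc N) (X.mainRep (level N) xm c)).re :=
  X.pos_of_localFactorisationAt D level loc F hF.1 hF.2

/-- **THE RAY FORM (R6, S13393)**: a factorisation with the face identity at EVERY base tuple of a set `S` (the Gram ray), with a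
UNIFORM depth `N₀`, gives the clause `posRay`: from depth `N₀` on, at every main class of every `y ∈ S`, the localised coefficient is
a non-negative real. -/
theorem pos_on_set_of_faceIdentity (D : X.ThetaData) (level : ℕ → X.Level) (loc : ∀ N : ℕ, X.Tr (level N))
    (S : Set X.Tuple) (N₀ : ℕ) (F : ∀ y ∈ S, X.LocalFactorisationAt D level loc y)
    (hN : ∀ y (hy : y ∈ S), (F y hy).N₀ ≤ N₀) (hF : ∀ y (hy : y ∈ S), (F y hy).FaceIdentity) :
    ∀ N, N₀ ≤ N → ∀ y ∈ S, ∀ c : X.MainClass (level N) y,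
      (X.coefQ D.cf (loc N) (X.mainRep (level N) y c)).im = 0 ∧
        0 ≤ (X.coefQ D.cf (loc N) (X.mainRep (level N) y c)).re := by
  intro N hN' y hy c
  exact X.pos_at_of_localFactorisationAt D level loc (F y hy) (hF y hy).1 (hF y hy).2 N (le_trans (hN y hy) hN') c

end T4Data

end Summit.Ventures.HodgeRepro.Tier4.Line3

end
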